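import Summits.KontsevichZagierPeriods.KontsevichZagierPeriods.Theses.RootDecompQuadraticDescent
import Literature.NumberTheory.Transcendental.KZCalculusProofs
import Literature.NumberTheory.Transcendental.SemialgebraicMapsProofs
import Literature.NumberTheory.Transcendental.KZSemialgebraicComplex

/-! # `RootDecompQuadraticDescentKMahlerPairP1` — part 1/2 of the mechanical ≤400-line split of `KMahlerPair.lean` (sha256 6cb18bbec4b26f58…)
Source: decomp-kz lens-6 g12 KMahlerPair.lean @6cb18bbe (critic CLEARED g6-5 l.1307); --supports stmt-KontsevichZagierPeriods-28994.
Split by census-1 g10 `gen/splitlean.py`: scopes re-opened with their `open`/`variable`/`set_option` context; mathematics and declaration order unchanged. -/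

/-!
# KMahlerPair — KMahler.lean @2c9ea7b0 VERBATIM (Part 1) + band representations, scaling/gluing moves and the PAIR FORM of K-M16/5 (Part 2)
(decomp-kz-lens-6, gen 12 addendum; route `RootDecompQuadraticDescent`, node `BlochAreaCarving` under `DescentTwoQ` 28994)

Kontsevich–Zagier (*Periods*, 2001, §1.2, right after the `ζ(2)` example) pose as an exercise «using only rules
1)–3)» the identity `m(x + y + 16 + 1/x + 1/y) = (11/6) · m(x + y + 5 + 1/x + 1/y)` between logarithmic Mahler
measures; its truth is a THEOREM since Lalín 2010 (IJNT 6, Thm 1 and §4: `m(16) = 11/6 · m(5) = 11 · m(1)`,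
proved through regulator identities between the ISOGENOUS conductor-15 curves `E₅`, `E₁₆`, `E₁` — Beilinson/Bloch
territory), and no chain of KZ moves is on record.  Here the two numbers are typed as values of ℚ-RATIONAL
TWO-dimensional Kontsevich–Zagier representations: by Jensen's formula in `y` and `t = tan(θ/2)`,
`π · m(x + 1/x + y + 1/y + k) = ∫∫_{D_k} 2 dt ds / ((1 + t²) s)` for `k ≥ 4`, with the ℚ-semialgebraic domain
`D_k = {(t, s) : 0 < t, 1 < s, (1 + t²)(s² + 1) < (k(1 + t²) + 2(1 − t²)) s}` (`s` runs between `1` and the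
larger root `y₊(θ)` of `y² − (k + 2 cos θ) y + 1`).  Numerical check (this generation): `m(5) = 1.5079826023`,
`m(16) = 2.7646347708`, ratio `1.8333333333 = 11/6`.

Content: `mahlerRep k : KZ.IntegralRep 2` (honest: semialgebraic domain, rational integrand `2 / ((1 + X₀²) X₁)`,
absolute convergence by domination with `2/(1+t²) · 1_{(1, k+2)}(s)`), `isRational_mahlerRep`, the census
statement `KM165 : Prop` (`6•[R₁₆] − 11•[R₅] ∈ KZ.relations`), the external value fact `KM165Values : Prop`
(Lalín's theorem + Jensen; NOT proved here, an explicit hypothesis), and `km165_of_kernelConjecture :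
KM165Values → KZKernelConjecture → KM165` (the instance is summit-implied given the value fact).  0 sorry.
References: Kontsevich–Zagier 2001 §1.2; Boyd 1998; Deninger 1997; Rodriguez-Villegas 1999; Lalín–Rogers 2007;
Lalín 2010; Brunault–Zudilin, *Many variations of Mahler measures*, §8.4.
-/

noncomputable section

open MeasureTheory Set MvPolynomial
open Literature.NumberTheory.Transcendental
open Literature.ModelTheory.ExponentialFields (IsSemialgebraic isSemialgebraic_setOf_eval_lt
  isSemialgebraic_setOf_eval_pos)

namespace Summit.KontsevichZagierPeriods.RootDecompQuadraticDescent.KMahler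

/-- Boyd's domain `D_k = {(t,s) : 0 < t ∧ 1 < s ∧ (1+t²)(s²+1) < (k(1+t²) + 2(1−t²))·s}` in `ℝ²`
(coordinates `w 0 = t = tan(θ/2)`, `w 1 = s`). (cite Boyd1998, §1) -/
def mahlerDom (k : ℕ) : Set (Fin 2 → ℝ) :=
  {w | 0 < w 0 ∧ 1 < w 1 ∧
    (1 + w 0 ^ 2) * (w 1 ^ 2 + 1) < ((k : ℝ) * (1 + w 0 ^ 2) + 2 * (1 - w 0 ^ 2)) * w 1}

/-- Numerator polynomial `2`. [folklore] -/
def pNum : MvPolynomial (Fin 2) ℚ := 2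

/-- Denominator polynomial `(1 + X₀²)·X₁`. [folklore] -/
def qDen : MvPolynomial (Fin 2) ℚ := (1 + X 0 ^ 2) * X 1

/-- Auxiliary step `aeval_pNum`: aeval p Num. [bookkeeping] -/
@[simp] theorem aeval_pNum (w : Fin 2 → ℝ) : aeval w pNum = 2 := by
  simp [pNum]

/-- Auxiliary step `aeval_qDen`: aeval q Den. [bookkeeping] -/
@[simp] theorem aeval_qDen (w : Fin 2 → ℝ) : aeval w qDen = (1 + w 0 ^ 2) * w 1 := by
  simp [qDen]

/-- `D_k` is `ℚ`-semialgebraic (three strict polynomial inequalities with rational coefficients).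
(cite KontsevichZagier2001, §1.1) -/
theorem isSemialgebraic_mahlerDom (k : ℕ) : IsSemialgebraic ℚ (mahlerDom k) := by
  have h1 : IsSemialgebraic ℚ {w : Fin 2 → ℝ | 0 < w 0} := by
    simpa using isSemialgebraic_setOf_eval_pos (k := ℚ) (R := ℝ) (X 0 : MvPolynomial (Fin 2) ℚ)
  have h2 : IsSemialgebraic ℚ {w : Fin 2 → ℝ | 1 < w 1} := by
    simpa using isSemialgebraic_setOf_eval_lt (k := ℚ) (R := ℝ) 1 (X 1 : MvPolynomial (Fin 2) ℚ)
  have h3 : IsSemialgebraic ℚ {w : Fin 2 → ℝ |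
      (1 + w 0 ^ 2) * (w 1 ^ 2 + 1) < ((k : ℝ) * (1 + w 0 ^ 2) + 2 * (1 - w 0 ^ 2)) * w 1} := by
    have e : {w : Fin 2 → ℝ |
        (1 + w 0 ^ 2) * (w 1 ^ 2 + 1) < ((k : ℝ) * (1 + w 0 ^ 2) + 2 * (1 - w 0 ^ 2)) * w 1} =
        {x : Fin 2 → ℝ | aeval x ((1 + X 0 ^ 2) * (X 1 ^ 2 + 1) : MvPolynomial (Fin 2) ℚ) <
          aeval x (((k : MvPolynomial (Fin 2) ℚ) * (1 + X 0 ^ 2) + 2 * (1 - X 0 ^ 2)) * X 1)} := by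
      ext w; simp
    rw [e]
    exact isSemialgebraic_setOf_eval_lt _ _
  have h : mahlerDom k = {w : Fin 2 → ℝ | 0 < w 0} ∩ ({w : Fin 2 → ℝ | 1 < w 1} ∩ {w : Fin 2 → ℝ |
      (1 + w 0 ^ 2) * (w 1 ^ 2 + 1) < ((k : ℝ) * (1 + w 0 ^ 2) + 2 * (1 - w 0 ^ 2)) * w 1}) := by
    ext w; simp [mahlerDom]
  rw [h]
  exact h1.inter (h2.inter h3)

/-- On `D_k` the second coordinate lies in `(1, k + 2)` (`s < y₊ ≤ k + 2 cos θ < k + 2`). [folklore] -/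
theorem mem_Ioo_of_mem_mahlerDom {k : ℕ} {w : Fin 2 → ℝ} (hw : w ∈ mahlerDom k) :
    w 1 ∈ Ioo (1 : ℝ) (k + 2) := by
  obtain ⟨_, h1, h3⟩ := hw
  refine ⟨h1, ?_⟩
  have ht : 0 < 1 + w 0 ^ 2 := by positivity
  have hle : ((k : ℝ) * (1 + w 0 ^ 2) + 2 * (1 - w 0 ^ 2)) * w 1 ≤ ((k : ℝ) + 2) * (1 + w 0 ^ 2) * w 1 := by
    nlinarith [sq_nonneg (w 0)]
  have h4 : (1 + w 0 ^ 2) * (w 1 ^ 2 + 1) < (1 + w 0 ^ 2) * (((k : ℝ) + 2) * w 1) := by nlinarith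
  have h5 : w 1 ^ 2 + 1 < ((k : ℝ) + 2) * w 1 := lt_of_mul_lt_mul_left h4 ht.le
  nlinarith

/-- The denominator does not vanish on `D_k`. [folklore] -/
theorem qDen_ne_zero {k : ℕ} (w : Fin 2 → ℝ) (hw : w ∈ mahlerDom k) : aeval w qDen ≠ 0 := by
  rw [aeval_qDen]
  have : 0 < 1 + w 0 ^ 2 := by positivity
  exact mul_ne_zero this.ne' (zero_lt_one.trans hw.2.1).ne'

/-- `D_k` is open, hence measurable. [folklore] -/
theorem measurableSet_mahlerDom (k : ℕ) : MeasurableSet (mahlerDom k) := by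
  have : IsOpen (mahlerDom k) := by
    have e : mahlerDom k = {w : Fin 2 → ℝ | 0 < w 0} ∩ ({w : Fin 2 → ℝ | 1 < w 1} ∩ {w : Fin 2 → ℝ |
        (1 + w 0 ^ 2) * (w 1 ^ 2 + 1) < ((k : ℝ) * (1 + w 0 ^ 2) + 2 * (1 - w 0 ^ 2)) * w 1}) := by
      ext w; simp [mahlerDom]
    rw [e]
    refine (isOpen_lt ?_ ?_).inter ((isOpen_lt ?_ ?_).inter (isOpen_lt ?_ ?_)) <;> fun_prop
  exact this.measurableSet

/-- **Absolute convergence**: `2/((1+t²)s)` is integrable on `D_k`, dominated by the integrable product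
`2(1+t²)⁻¹ · 1_{(1,k+2)}(s)`. [folklore] -/
theorem integrableOn_mahler (k : ℕ) :
    IntegrableOn (fun w : Fin 2 → ℝ => aeval w pNum / aeval w qDen) (mahlerDom k) := by
  set φ : ℝ → ℝ := fun t => 2 * (1 + t ^ 2)⁻¹ with hφ_def
  set ψ : ℝ → ℝ := (Ioo (1 : ℝ) (k + 2)).indicator fun _ => (1 : ℝ) with hψ_def
  have hφ : Integrable φ := integrable_inv_one_add_sq.const_mul 2
  have hψ : Integrable ψ := by
    refine (integrable_indicator_iff measurableSet_Ioo).mpr ?_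
    exact (integrableOn_const (measure_Ioo_lt_top (a := (1 : ℝ)) (b := (k : ℝ) + 2)).ne)
  have hg : Integrable (fun w : Fin 2 → ℝ => φ (w 0) * ψ (w 1)) := by
    have h := Integrable.fintype_prod (ι := Fin 2) (f := ![φ, ψ])
      (μ := fun _ => (volume : Measure ℝ))
      (Fin.forall_fin_two.mpr ⟨by simpa using hφ, by simpa using hψ⟩)
    refine h.congr (Filter.Eventually.of_forall fun w => ?_)
    simp [Fin.prod_univ_two]
  have hmeas : Measurable (fun w : Fin 2 → ℝ => aeval w pNum / aeval w qDen) := by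
    have : (fun w : Fin 2 → ℝ => aeval w pNum / aeval w qDen) =
        fun w : Fin 2 → ℝ => 2 / ((1 + w 0 ^ 2) * w 1) := by
      funext w; rw [aeval_pNum, aeval_qDen]
    rw [this]
    fun_prop
  refine Integrable.mono' hg.integrableOn hmeas.aestronglyMeasurable ?_
  refine ae_restrict_of_forall_mem (measurableSet_mahlerDom k) fun w hw => ?_
  have hs := mem_Ioo_of_mem_mahlerDom hw
  have hψw : ψ (w 1) = 1 := by simp [hψ_def, indicator_of_mem hs]
  rw [aeval_pNum, aeval_qDen, hψw, mul_one, Real.norm_eq_abs]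
  have ht : 0 < 1 + w 0 ^ 2 := by positivity
  have hs1 : 1 < w 1 := hs.1
  rw [abs_of_pos (by positivity), hφ_def]
  dsimp only
  rw [div_le_iff₀ (by positivity)]
  have : 2 * (1 + w 0 ^ 2)⁻¹ * ((1 + w 0 ^ 2) * w 1) = 2 * w 1 := by
    field_simp
  rw [this]
  linarith

/-- **The Boyd–Mahler representation `R_k = [D_k, 2/((1+t²)s)]`**, a ℚ-rational two-dimensional
Kontsevich–Zagier representation whose value is `π · m(x + 1/x + y + 1/y + k)` for `k ≥ 4` (Jensen's formula;
the identification is not formalised here). (cite KontsevichZagier2001, §1.2) (cite Boyd1998, §1) -/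
def mahlerRep (k : ℕ) : KZ.IntegralRep 2 :=
  KZ.IntegralRep.ofRational (mahlerDom k) pNum qDen (isSemialgebraic_mahlerDom k)
    (fun w hw => qDen_ne_zero w hw) (integrableOn_mahler k)

/-- `R_k` has KZ's literal rational shape. (cite KontsevichZagier2001, §1.1) -/
theorem isRational_mahlerRep (k : ℕ) : (mahlerRep k).IsRational :=
  KZ.IntegralRep.isRational_ofRational _ _ _ _ _ _

/-- The domain of `R_k` is `D_k`. [folklore] -/
@[simp] theorem domain_mahlerRep (k : ℕ) : (mahlerRep k).domain = mahlerDom k := rfl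

/-- The value of `R_k` is `∫∫_{D_k} 2 / ((1 + t²) s)`. [folklore] -/
theorem value_mahlerRep (k : ℕ) :
    (mahlerRep k).value = ∫ w in mahlerDom k, 2 / ((1 + w 0 ^ 2) * w 1) := by
  rw [mahlerRep, KZ.IntegralRep.value_ofRational]
  refine setIntegral_congr_fun (measurableSet_mahlerDom k) fun w _ => ?_
  simp only [aeval_pNum, aeval_qDen]

/-- **K-M16/5, VALUE SIDE (external theorem, an explicit hypothesis here)**: `6 · value(R₁₆) = 11 · value(R₅)`,
i.e. `6π·m(P₁₆) = 11π·m(P₅)` — Kontsevich–Zagier's «accessible identity» (2001, §1.2), proved by Lalín (IJNT 6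
(2010), Thm 1, §4) via regulators of the isogenous conductor-15 curves. (cite Lalin2010, Thm 1) -/
def KM165Values : Prop :=
  6 * (mahlerRep 16).value = 11 * (mahlerRep 5).value

/-- **K-M16/5, MOVE SIDE (the census question of piece A)**: is `6•[R₁₆] − 11•[R₅]` a relation of the KZ
calculus?  An INSTANCE of `OffTetraOffAreaDescentTwoQ` off both oracles: the polar curve
`(1+t²)(s²+1) = (k(1+t²)+2(1−t²))s` is the genus-1 curve `E_k` (not Tate, not an area pair).
(cite KontsevichZagier2001, §1.2) (cite Lalin2010, Thm 1) -/
def KM165 : Prop :=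
  (6 : ℤ) • KZ.of (mahlerRep 16) - (11 : ℤ) • KZ.of (mahlerRep 5) ∈ KZ.relations

/-- Given the value identity, K-M16/5 is implied by the kernel form of Conjecture 1 (hence by the summit,
`kzKernelConjecture_iff_isRational`). (cite KontsevichZagier2001, §1.2) -/
theorem km165_of_kernelConjecture (hV : KM165Values) (h : KZKernelConjecture) : KM165 := by
  refine h _ ?_
  rw [map_sub, map_zsmul, map_zsmul, KZ.eval_of, KZ.eval_of, zsmul_eq_mul, zsmul_eq_mul]
  unfold KM165Values at hV
  push_cast
  linarith

/-- … hence by the summit statement. [folklore] -/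
theorem km165_of_summit (hV : KM165Values) (h : KontsevichZagierPeriods) : KM165 :=
  km165_of_kernelConjecture hV (kzKernelConjecture_iff_isRational.mpr (KontsevichZagierPeriods_iff.mp h))

end Summit.KontsevichZagierPeriods.RootDecompQuadraticDescent.KMahler

/-! # Part 2 (gen 12, addendum 3): BAND REPRESENTATIONS — the scaling move, the gluing move, the band class,
and the PAIR FORM of K-M16/5

All Boyd–Mahler representations `R_k` share ONE integrand `2/(u(1+τ²))` and live in the band `1 < u < k + 2`.  The
2-form `c·dτ du/(u(1+τ²)) = c·d(arctan τ) ∧ d(log u)` is invariant under the `u`-scalings `(τ,u) ↦ (τ, L u)`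
(rule (2), Jacobian `L`), so finitely many band representations with the same `c` can always be stacked into
DISJOINT bands and glued (rule (1a)) into ONE band representation — which is again ℚ-rational with the same
`(p, q) = (c, X₁(1+X₀²))`.  Consequently the classes `{x | x ≡ [r] − [r′], r r′ band}` form an ADDITIVE SUBGROUP
of `FormalRep` (`band c`), and every ℤ-combination of band representations is congruent modulo `KZ.relations` to a
difference of two ℚ-rational two-dimensional representations.  Applied to `6•[R₁₆] − 11•[R₅]`: K-M16/5 is
LITERALLY an instance `(r, r′)` of the conclusion of `DescentTwoQ` / Conjecture 1 (`km165_pair`,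
`km165_iff_equivalent`).  (The same two moves are the "blob" half of the packing argument for the tetrahedral
family of NODE §13; its "horn" half needs Möbius rotations in `τ` and is not attempted here.)  0 sorry.
-/

namespace Summit.KontsevichZagierPeriods.RootDecompQuadraticDescent.BandMerge

open Summit.KontsevichZagierPeriods.RootDecompQuadraticDescent.KMahler

/-- The common integrand `c/(u(1+τ²))` (`w 0 = τ`, `w 1 = u`). (cite KontsevichZagier2001, §1.1) -/
def hC (c : ℚ) (w : Fin 2 → ℝ) : ℝ := (c : ℝ) / (w 1 * (1 + w 0 ^ 2))

/-- A BAND representation of height `M`: integrand `c/(u(1+τ²))` on the domain, domain inside `{1 < u < M}`.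
[folklore] -/
def IsBand (c : ℚ) (M : ℕ) (r : KZ.IntegralRep 2) : Prop :=
  EqOn r.integrand (hC c) r.domain ∧ r.domain ⊆ {w | 1 < w 1 ∧ w 1 < M}

/-- Auxiliary step `pos`: pos. [bookkeeping] -/
theorem IsBand.pos {c : ℚ} {M : ℕ} {r : KZ.IntegralRep 2} (h : IsBand c M r) :
    ∀ w ∈ r.domain, 0 < w 1 :=
  fun _ hw => zero_lt_one.trans (h.2 hw).1

/-- `c/(u(1+τ²))` is a `ℚ`-semialgebraic function on every `ℚ`-semialgebraic `σ ⊆ {u > 0}`.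
(cite KontsevichZagier2001, §1.1) -/
theorem hC_isSemialgebraicFunOn (c : ℚ) {σ : Set (Fin 2 → ℝ)} (hσ : IsSemialgebraic ℚ σ)
    (hpos : ∀ w ∈ σ, 0 < w 1) : IsSemialgebraicFunOn ℚ σ (hC c) := by
  have hnum : IsSemialgebraicFunOn ℚ σ (fun _ => ((c : ℚ) : ℝ)) :=
    (isSemialgebraicFunOn_aeval hσ (C c : MvPolynomial (Fin 2) ℚ)).congr fun w _ => by
      simp [eq_ratCast]
  have hden : IsSemialgebraicFunOn ℚ σ (fun w => w 1 * (1 + w 0 ^ 2)) :=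
    (isSemialgebraicFunOn_aeval hσ (X 1 * (1 + X 0 ^ 2) : MvPolynomial (Fin 2) ℚ)).congr
      fun w _ => by simp
  have h := hnum.div hden fun w hw => by
    have h1 : 0 < w 1 := hpos w hw
    positivity
  exact h.congr fun w _ => by simp only [hC]

/-- A representation with integrand `c/(u(1+τ²))` on a domain inside `{u > 0}` has KZ's literal rational shape,
`(p, q) = (c, X₁(1 + X₀²))`. (cite KontsevichZagier2001, §1.1 Definition) -/
theorem isRational_of_hC {c : ℚ} (r : KZ.IntegralRep 2) (hri : EqOn r.integrand (hC c) r.domain)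
    (hpos : ∀ w ∈ r.domain, 0 < w 1) : r.IsRational := by
  refine ⟨C c, X 1 * (1 + X 0 ^ 2), fun x hx => ?_, fun x hx => ?_⟩
  · have hu := hpos x hx
    simp only [map_mul, MvPolynomial.aeval_X, map_add, map_one, map_pow]
    positivity
  · rw [hri hx, hC]
    simp [eq_ratCast]

/-- Auxiliary step `isRational`: is Rational. [bookkeeping] -/
theorem IsBand.isRational {c : ℚ} {M : ℕ} {r : KZ.IntegralRep 2} (h : IsBand c M r) : r.IsRational :=
  isRational_of_hC r h.1 h.pos

/-! ## The scaling move `(τ, u) ↦ (τ, L·u)` -/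

/-- Auxiliary step `scale_apply`: scale apply. [bookkeeping] -/
theorem scale_apply {L : ℝ} (Φ : (Fin 2 → ℝ) → (Fin 2 → ℝ)) (hΦ : ∀ w, Φ w = ![w 0, L * w 1])
    (w : Fin 2 → ℝ) : Φ w 0 = w 0 ∧ Φ w 1 = L * w 1 := by
  rw [hΦ]
  simp

/-- Auxiliary step `scale_injOn`: scale inj On. [bookkeeping] -/
theorem scale_injOn {L : ℝ} (hL : L ≠ 0) (Φ : (Fin 2 → ℝ) → (Fin 2 → ℝ))
    (hΦ : ∀ w, Φ w = ![w 0, L * w 1]) (σ : Set (Fin 2 → ℝ)) : InjOn Φ σ := by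
  intro x _ y _ hxy
  have h0 := congrFun hxy 0
  have h1 := congrFun hxy 1
  rw [(scale_apply Φ hΦ x).1, (scale_apply Φ hΦ y).1] at h0
  rw [(scale_apply Φ hΦ x).2, (scale_apply Φ hΦ y).2] at h1
  have h1' : x 1 = y 1 := mul_left_cancel₀ hL h1
  funext i
  fin_cases i
  · exact h0
  · exact h1'

/-- Auxiliary step `scale_isSemialgebraicMapOn`: scale is Semialgebraic Map On. [bookkeeping] -/
theorem scale_isSemialgebraicMapOn (L : ℕ) (Φ : (Fin 2 → ℝ) → (Fin 2 → ℝ))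
    (hΦ : ∀ w, Φ w = ![w 0, (L : ℝ) * w 1]) {σ : Set (Fin 2 → ℝ)} (hσ : IsSemialgebraic ℚ σ) :
    IsSemialgebraicMapOn ℚ σ Φ := by
  have s0 : IsSemialgebraicFunOn ℚ σ (fun w => w 0) :=
    (isSemialgebraicFunOn_aeval hσ (X 0)).congr fun w _ => by simp
  have s1 : IsSemialgebraicFunOn ℚ σ (fun w => (L : ℝ) * w 1) :=
    (isSemialgebraicFunOn_aeval hσ (C (L : ℚ) * X 1)).congr fun w _ => by simp
  refine IsSemialgebraicMapOn.of_forall hσ fun j => ?_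
  fin_cases j
  · exact s0.congr fun w _ => by simp [(scale_apply Φ hΦ w).1]
  · exact s1.congr fun w _ => by simp [(scale_apply Φ hΦ w).2]

/-- Auxiliary step `scale_hasFDerivAt_det`: scale has FDeriv At det. [bookkeeping] -/
theorem scale_hasFDerivAt_det {L : ℝ} (Φ : (Fin 2 → ℝ) → (Fin 2 → ℝ))
    (hΦ : ∀ w, Φ w = ![w 0, L * w 1]) (x : Fin 2 → ℝ) :
    ∃ A : (Fin 2 → ℝ) →L[ℝ] (Fin 2 → ℝ), HasFDerivAt Φ A x ∧ A.det = L := by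
  set M : Matrix (Fin 2) (Fin 2) ℝ := !![1, 0; 0, L] with hM
  refine ⟨LinearMap.toContinuousLinearMap (Matrix.toLin' M), ?_, ?_⟩
  · have e0 : HasFDerivAt (fun y : Fin 2 → ℝ => y 0) (ContinuousLinearMap.proj 0) x :=
      hasFDerivAt_apply (𝕜 := ℝ) 0 x
    have e1 : HasFDerivAt (fun y : Fin 2 → ℝ => y 1) (ContinuousLinearMap.proj 1) x :=
      hasFDerivAt_apply (𝕜 := ℝ) 1 x
    have h0 : HasFDerivAt (fun y => Φ y 0)
        ((ContinuousLinearMap.proj 0).comp (LinearMap.toContinuousLinearMap (Matrix.toLin' M))) x := by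
      have hf : (fun y => Φ y 0) = fun y : Fin 2 → ℝ => y 0 := by
        funext y
        exact (scale_apply Φ hΦ y).1
      rw [hf]
      refine e0.congr_fderiv (ContinuousLinearMap.ext fun u => ?_)
      simp [hM, Matrix.toLin'_apply, dotProduct, Fin.sum_univ_two]
    have h1 : HasFDerivAt (fun y => Φ y 1)
        ((ContinuousLinearMap.proj 1).comp (LinearMap.toContinuousLinearMap (Matrix.toLin' M))) x := by
      have hf : (fun y => Φ y 1) = fun y : Fin 2 → ℝ => L * y 1 := by
        funext y
        exact (scale_apply Φ hΦ y).2
      rw [hf]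
      refine (e1.const_mul L).congr_fderiv (ContinuousLinearMap.ext fun u => ?_)
      simp [hM, Matrix.toLin'_apply, dotProduct, Fin.sum_univ_two]
    refine hasFDerivAt_pi'' fun i => ?_
    fin_cases i
    exacts [h0, h1]
  · rw [LinearMap.det_toContinuousLinearMap, LinearMap.det_toLin', Matrix.det_fin_two]
    simp [hM]

end Summit.KontsevichZagierPeriods.RootDecompQuadraticDescent.BandMerge
end
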